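import Summits.QuantumFields.YangMills.Theorems.BalabanUVNodesN15KingModelCurvatureStaggered
import Summits.QuantumFields.YangMills.Theorems.BalabanUVNodesN15KingModelCurvatureFlux
import Summits.QuantumFields.YangMills.Theorems.BalabanUVNodesN15KingModelCovariantRandomWalk
import HarnessLib

/-!
# BalabanUVNodes ∕ N15 — THE KING-MODEL RUNG (PART Ϳ-j): THE CURVATURE MASS IS STABLE AND GAUGE INVARIANT — plaquettes are `4`-Lipschitz in the link field (operator norm), so every
# unitary field within `ε` (bondwise) of a field with plaquette bound `γ` has plaquette bound `γ + 4ε` and mass `2c·λ(γ+4ε)`: OPEN SETS of non-constant, NON-ABELIAN link fields around the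
# constant-flux field (`U(1)`) and around the Kogut–Susskind field (any `U(n)`, `ε < 1∕2`) have a UNIFORM massless gap; the hypothesis and the mass are gauge invariant
# (Track A, DAG node N15 = NE2; FAN-OUT v1.1 §N15 s3 «KING-MODEL RUNG … + what the curved case adds»; count-neutral)

HONEST FRAMING.  Count-neutral (cell `pub-ymgap`, seat `pub-ymgap-dag-n15-e` g46; `--supports stmt-QuantumFields-27247 --as helper` = K3ᴬ, KEY MAP v3).  King's fine covariance layer
`−cΔ_U+m²` (Ͱ-a `covLapF`) on ONE finite torus; elementary operator-norm bookkeeping; NOT Bałaban's `G_k(U)`; NOT [Balaban1985BackgroundPropagators] (3.42); NOT a node discharge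
(N15 of record untouched); nothing continuum ∕ ℝ⁴ ∕ OS ∕ Clay.

THE RESULTS (`K` any period vector, `c ≥ 0`, any `m²`, fibre `𝕜ⁿ`, Mathlib's `L2Operator` norm on `Matrix n n 𝕜`):
* §1 `l2_opNorm_mul_sub_mul_le` (`‖A′B′ − AB‖ ≤ ‖A′−A‖‖B′‖ + ‖A‖‖B′−B‖`), ★★ **`norm_kingPlaq_sub_le`** — for unitary `U, V` with `‖V(b) − U(b)‖ ≤ ε` on every bond: `‖P_V(x,μ,ν) − P_U(x,μ,ν)‖ ≤ 4ε` (the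
  plaquette is `4`-Lipschitz: telescoping through four unitary factors of norm `≤ 1`, Ͱ-k `l2_opNorm_of_mem_unitaryGroup_le`);
* §2 `re_inner_toEuclideanLin_sub_le` (`|Re⟪u,(A−B)u⟫| ≤ ‖A−B‖‖u‖²`), ★★ **`plaq_hyp_of_near`** (`Re⟪u,P_Uu⟫ ≤ γ‖u‖²` everywhere ⟹ `Re⟪u,P_Vu⟫ ≤ (γ+4ε)‖u‖²` everywhere), ★★★
  **`re_quadForm_covLapF_ge_plaq_of_near`** (`(m² + 2c·λ(γ+4ε))Σ‖v_x‖² ≤ Re⟨v,(−cΔ_V+m²)v⟩` for EVERY unitary `V` in the bondwise `ε`-ball around `U`), ★★ `re_quadForm_covLapF_ge_plaq_all_of_near`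
  (all planes: `m² + (d+1)c·λ(γ+4ε)`);
* §3 ★★★ **`re_quadForm_covLapF_ge_near_fluxLink`** — every `U(1)` field `V` with `‖V(b) − fluxLink(b)‖ ≤ ε`: mass `2c·λ(cos p′_{ν₀} + 4ε)`; ★★ `posDef_covLapF_massless_near_fluxLink`
  (`cos p′ + 4ε < 1`, `c > 0`: the massless gap SURVIVES small inhomogeneous perturbations of the flux field); ★★★ **`re_quadForm_covLapF_ge_near_ks`** — every `U(n)`-valued field `V` with
  `‖V(b) − η_μ(x)·1‖ ≤ ε` (all `K` even, `d ≥ 1`): mass `(d+1)c·λ(4ε − 1)`; ★★★ **`posDef_covLapF_massless_near_ks`** (`ε < 1∕2`, `c > 0`): an OPEN BALL OF NON-ABELIAN, NON-CONSTANT link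
  fields around the `ℤ₂` maximal-flux field carries a UNIFORM massless gap `(d+1)c·λ(4ε−1) > 0`;
* §4 GAUGE INVARIANCE: `re_inner_conj_plaq` (`Re⟪u, gPg^*u⟫ = Re⟪g^*u, P(g^*u)⟫`), ★★ **`plaq_hyp_kingGaugeAct`** (the numerical-range hypothesis is gauge invariant, Ͻ-q `kingPlaq_kingGaugeAct`), ★★
  `re_quadForm_covLapF_ge_plaq_gauge` (so is the mass bound — on the whole gauge orbit, e.g. of the flux and KS fields).
WHAT THE CURVED CASE ADDS (as theorems): the curvature mass is a ROBUST, GAUGE-INVARIANT, NON-PERTURBATIVE-in-`n` property of an open region of link-field space — not an artefact of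
constant or abelian curvature.
PRIOR TREE ART (by name, not restated): Ϳ-a (`plaqGap`, `plaqGap_neg_one`, `plaqGap_cos`), Ϳ-b (`re_quadForm_covLapF_ge_plaq`, `re_quadForm_covLapF_ge_plaq_all`, `posDef_covLapF_of_plaq`), Ϳ-c
(`re_inner_plaq_unit`, `re_kingPlaq_fluxLink`, `plaqGap_pos_of_lt_one`), Ϳ-d (`re_inner_toEuclideanLin_neg_one`), Ϳ-e (`ksLink`, `kingPlaq_ks`, `ksLink_mem_unitaryGroup`), Ͱ-a (`covLapF`, `kingGaugeAct`, `kingGaugeAct_mem_unitaryGroup`,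
`isHermitian_covLapF`), Ͱ-b (`fib`, `norm_toEuclideanLin_of_mem_unitaryGroup`), Ͱ-d (`im_quadForm_covLapF`), Ͱ-f (`sum_norm_fib_sq`), Ͱ-k (`l2_opNorm_of_mem_unitaryGroup_le`), Ͻ-q (`kingPlaq`,
`kingPlaq_kingGaugeAct`, `fluxLink`, `fluxLink_mem_unitaryGroup`, `conjTranspose_mul_self_of_mem`), `B5Prop11Plancherel` (`sOf`, `abs_sOf_le`), Mathlib (`Matrix.cstar_norm_def`, `Matrix.l2_opNorm_conjTranspose`,
`norm_mul_le`).  Dedup (rg at filing): basename 0 files; needles `norm_kingPlaq_sub_le|plaq_hyp_of_near|re_quadForm_covLapF_ge_plaq_of_near|re_quadForm_covLapF_ge_near_ks|posDef_covLapF_massless_near_ks|plaq_hyp_kingGaugeAct`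
0 tree files.  Locators: [DodziukMathai2006] §1 Cor 1.3; [King1986] (2.12) p.653, (4.4) p.670; [Balaban1985BackgroundPropagators] (3.23) p.394, p.398 l.19 (gauge transformations).  0 `sorry`, 0 `def`.
-/

noncomputable section
open scoped BigOperators ComplexConjugate ComplexOrder InnerProductSpace Matrix.Norms.L2Operator
open Finset Matrix WithLp

namespace Summit.QuantumFields.YangMills.BalabanUVNodes.N15KingModelRung.Curvature

open Literature.MathematicalPhysics.QuantumFieldTheory.Balaban1983to89.B5Prop11Plancherel (Tor unitVec sOf abs_sOf_le)
open Summit.QuantumFields.YangMills.BalabanUVNodes.N15KingModelRung.Covariant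
  (covLapF fib kingGaugeAct kingGaugeAct_mem_unitaryGroup isHermitian_covLapF im_quadForm_covLapF sum_norm_fib_sq norm_toEuclideanLin_of_mem_unitaryGroup l2_opNorm_of_mem_unitaryGroup_le)
open Summit.QuantumFields.YangMills.BalabanUVNodes.N15KingModelRung.Cover (kingPlaq kingPlaq_kingGaugeAct fluxLink fluxLink_mem_unitaryGroup conjTranspose_mul_self_of_mem)

variable {d : ℕ} (K : Fin (d + 1) → ℕ)
variable {𝕜 : Type*} [RCLike 𝕜] {n : Type*} [Fintype n] [DecidableEq n]

/-! ## §1 Plaquettes are `4`-Lipschitz in the link field -/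

section Lipschitz

omit [DecidableEq n] in
/-- `‖A′B′ − AB‖ ≤ ‖A′−A‖·‖B′‖ + ‖A‖·‖B′−B‖` (`A′B′ − AB = (A′−A)B′ + A(B′−B)`). [folklore] -/
theorem l2_opNorm_mul_sub_mul_le [DecidableEq n] (A A' B B' : Matrix n n 𝕜) : ‖A' * B' - A * B‖ ≤ ‖A' - A‖ * ‖B'‖ + ‖A‖ * ‖B' - B‖ := by
  have h : A' * B' - A * B = (A' - A) * B' + A * (B' - B) := by noncomm_ring
  rw [h]
  exact (norm_add_le _ _).trans (add_le_add (Matrix.l2_opNorm_mul _ _) (Matrix.l2_opNorm_mul _ _))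

variable [hK : ∀ μ, NeZero (K μ)]

omit hK in
/-- ★★ **THE PLAQUETTE IS `4`-LIPSCHITZ**: for unitary link fields `U, V` with `‖V(b) − U(b)‖ ≤ ε` on every bond, `‖P_V(x,μ,ν) − P_U(x,μ,ν)‖ ≤ 4ε` (telescoping through the four unitary
factors, each of operator norm `≤ 1`). [cite: King1986, (2.12) p.653] -/
theorem norm_kingPlaq_sub_le {U V : Tor K × Fin (d + 1) → Matrix n n 𝕜} (hU : ∀ b, U b ∈ Matrix.unitaryGroup n 𝕜) (hV : ∀ b, V b ∈ Matrix.unitaryGroup n 𝕜) {ε : ℝ}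
    (hε : ∀ b, ‖V b - U b‖ ≤ ε) (x : Tor K) (μ ν : Fin (d + 1)) : ‖kingPlaq K V x μ ν - kingPlaq K U x μ ν‖ ≤ 4 * ε := by
  have hε0 : 0 ≤ ε := (norm_nonneg _).trans (hε (x, μ))
  have hu : ∀ {W : Matrix n n 𝕜}, W ∈ Matrix.unitaryGroup n 𝕜 → ‖W‖ ≤ 1 := fun h => l2_opNorm_of_mem_unitaryGroup_le h
  have huH : ∀ {W : Matrix n n 𝕜}, W ∈ Matrix.unitaryGroup n 𝕜 → ‖Wᴴ‖ ≤ 1 := fun h => by rw [Matrix.l2_opNorm_conjTranspose]; exact hu h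
  have hεH : ∀ b, ‖(V b)ᴴ - (U b)ᴴ‖ ≤ ε := fun b => by rw [← Matrix.conjTranspose_sub, Matrix.l2_opNorm_conjTranspose]; exact hε b
  -- the four factors
  set A := U (x, μ); set A' := V (x, μ)
  set B := U (x + unitVec K μ, ν); set B' := V (x + unitVec K μ, ν)
  set C := (U (x + unitVec K ν, μ))ᴴ; set C' := (V (x + unitVec K ν, μ))ᴴ
  set D := (U (x, ν))ᴴ; set D' := (V (x, ν))ᴴ
  have h1 : ‖A' * B' - A * B‖ ≤ 2 * ε := by
    calc ‖A' * B' - A * B‖ ≤ ‖A' - A‖ * ‖B'‖ + ‖A‖ * ‖B' - B‖ := l2_opNorm_mul_sub_mul_le A A' B B'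
      _ ≤ ε * 1 + 1 * ε := add_le_add (mul_le_mul (hε _) (hu (hV _)) (norm_nonneg _) hε0) (mul_le_mul (hu (hU _)) (hε _) (norm_nonneg _) zero_le_one)
      _ = 2 * ε := by ring
  have hAB : ‖A * B‖ ≤ 1 := (Matrix.l2_opNorm_mul _ _).trans (by nlinarith [hu (hU (x, μ)), hu (hU (x + unitVec K μ, ν)), norm_nonneg A, norm_nonneg B])
  have h2 : ‖A' * B' * C' - A * B * C‖ ≤ 3 * ε := by
    calc ‖A' * B' * C' - A * B * C‖ ≤ ‖A' * B' - A * B‖ * ‖C'‖ + ‖A * B‖ * ‖C' - C‖ := l2_opNorm_mul_sub_mul_le (A * B) (A' * B') C C'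
      _ ≤ 2 * ε * 1 + 1 * ε := add_le_add (mul_le_mul h1 (huH (hV _)) (norm_nonneg _) (by linarith)) (mul_le_mul hAB (hεH _) (norm_nonneg _) zero_le_one)
      _ = 3 * ε := by ring
  have hABC : ‖A * B * C‖ ≤ 1 := (Matrix.l2_opNorm_mul _ _).trans (by nlinarith [hAB, huH (hU (x + unitVec K ν, μ)), norm_nonneg (A * B), norm_nonneg C])
  calc ‖kingPlaq K V x μ ν - kingPlaq K U x μ ν‖ = ‖A' * B' * C' * D' - A * B * C * D‖ := rfl
    _ ≤ ‖A' * B' * C' - A * B * C‖ * ‖D'‖ + ‖A * B * C‖ * ‖D' - D‖ := l2_opNorm_mul_sub_mul_le (A * B * C) (A' * B' * C') D D'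
    _ ≤ 3 * ε * 1 + 1 * ε := add_le_add (mul_le_mul h2 (huH (hV _)) (norm_nonneg _) (by linarith)) (mul_le_mul hABC (hεH _) (norm_nonneg _) zero_le_one)
    _ = 4 * ε := by ring

end Lipschitz

/-! ## §2 The plaquette hypothesis and the mass move continuously with the field -/

section Near

variable [hK : ∀ μ, NeZero (K μ)] {c : ℝ}

omit hK in
/-- `Re⟪u, (A − B)u⟫ ≤ ‖A − B‖·‖u‖²`. [folklore] -/
theorem re_inner_toEuclideanLin_sub_le (A B : Matrix n n 𝕜) (u : EuclideanSpace 𝕜 n) :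
    RCLike.re ⟪u, Matrix.toEuclideanLin A u⟫_𝕜 - RCLike.re ⟪u, Matrix.toEuclideanLin B u⟫_𝕜 ≤ ‖A - B‖ * ‖u‖ ^ 2 := by
  rw [← map_sub, ← inner_sub_right, ← LinearMap.sub_apply, ← map_sub]
  have h1 : ‖Matrix.toEuclideanLin (A - B) u‖ ≤ ‖A - B‖ * ‖u‖ := by
    rw [Matrix.cstar_norm_def]
    exact (Matrix.toEuclideanCLM (n := n) (𝕜 := 𝕜) (A - B)).le_opNorm u
  calc RCLike.re ⟪u, Matrix.toEuclideanLin (A - B) u⟫_𝕜 ≤ ‖u‖ * ‖Matrix.toEuclideanLin (A - B) u‖ := re_inner_le_norm _ _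
    _ ≤ ‖u‖ * (‖A - B‖ * ‖u‖) := mul_le_mul_of_nonneg_left h1 (norm_nonneg _)
    _ = ‖A - B‖ * ‖u‖ ^ 2 := by ring

omit hK in
/-- ★★ **THE HYPOTHESIS MOVES BY `4ε`**: if `Re⟪u, P_U(x,ν₀,ν₁)u⟫ ≤ γ‖u‖²` at every site and `‖V(b) − U(b)‖ ≤ ε` on every bond (both unitary), then `Re⟪u, P_V(x,ν₀,ν₁)u⟫ ≤ (γ+4ε)‖u‖²`.
[cite: King1986, (2.12) p.653; DodziukMathai2006, Cor 1.3 §1] -/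
theorem plaq_hyp_of_near {U V : Tor K × Fin (d + 1) → Matrix n n 𝕜} (hU : ∀ b, U b ∈ Matrix.unitaryGroup n 𝕜) (hV : ∀ b, V b ∈ Matrix.unitaryGroup n 𝕜) {ε : ℝ}
    (hε : ∀ b, ‖V b - U b‖ ≤ ε) {ν₀ ν₁ : Fin (d + 1)} {γ : ℝ} (hγ : ∀ x, ∀ u : EuclideanSpace 𝕜 n, RCLike.re ⟪u, Matrix.toEuclideanLin (kingPlaq K U x ν₀ ν₁) u⟫_𝕜 ≤ γ * ‖u‖ ^ 2)
    (x : Tor K) (u : EuclideanSpace 𝕜 n) : RCLike.re ⟪u, Matrix.toEuclideanLin (kingPlaq K V x ν₀ ν₁) u⟫_𝕜 ≤ (γ + 4 * ε) * ‖u‖ ^ 2 := by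
  have h1 := re_inner_toEuclideanLin_sub_le (kingPlaq K V x ν₀ ν₁) (kingPlaq K U x ν₀ ν₁) u
  have h2 := mul_le_mul_of_nonneg_right (norm_kingPlaq_sub_le K hU hV hε x ν₀ ν₁) (sq_nonneg ‖u‖)
  have h3 := hγ x u
  linarith

/-- ★★★ **THE CURVATURE MASS ON AN OPEN BALL OF FIELDS** (any fibre, `c ≥ 0`, `ν₀ ≠ ν₁`): if `U` has plaquette bound `γ` and `V` is any unitary field with `‖V(b) − U(b)‖ ≤ ε` on every bond, then
`(m² + 2c·λ(γ+4ε))·Σ‖v_x‖² ≤ Re⟨v, (−cΔ_V+m²)v⟩`. [cite: DodziukMathai2006, Cor 1.3 §1; King1986, (4.4) p.670; Balaban1985BackgroundPropagators, (3.23) p.394] -/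
theorem re_quadForm_covLapF_ge_plaq_of_near (hc : 0 ≤ c) (m2 : ℝ) {U V : Tor K × Fin (d + 1) → Matrix n n 𝕜} (hU : ∀ b, U b ∈ Matrix.unitaryGroup n 𝕜)
    (hV : ∀ b, V b ∈ Matrix.unitaryGroup n 𝕜) {ε : ℝ} (hε : ∀ b, ‖V b - U b‖ ≤ ε) {ν₀ ν₁ : Fin (d + 1)} (hν : ν₀ ≠ ν₁) {γ : ℝ}
    (hγ : ∀ x, ∀ u : EuclideanSpace 𝕜 n, RCLike.re ⟪u, Matrix.toEuclideanLin (kingPlaq K U x ν₀ ν₁) u⟫_𝕜 ≤ γ * ‖u‖ ^ 2) (v : Tor K × n → 𝕜) :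
    (m2 + 2 * c * plaqGap (γ + 4 * ε)) * ∑ x, ‖fib K v x‖ ^ 2 ≤ RCLike.re (star v ⬝ᵥ (covLapF K c m2 V *ᵥ v)) :=
  re_quadForm_covLapF_ge_plaq K hc m2 hV hν (plaq_hyp_of_near K hU hV hε hγ) v

/-- ★★ All planes: `(m² + (d+1)c·λ(γ+4ε))·Σ‖v_x‖² ≤ Re⟨v,(−cΔ_V+m²)v⟩` for every unitary `V` in the `ε`-ball around a field `U` whose every plaquette has bound `γ` (`d ≥ 1`).
[cite: DodziukMathai2006, Cor 1.3 §1; King1986, (4.4) p.670] -/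
theorem re_quadForm_covLapF_ge_plaq_all_of_near (hd : 0 < d) (hc : 0 ≤ c) (m2 : ℝ) {U V : Tor K × Fin (d + 1) → Matrix n n 𝕜} (hU : ∀ b, U b ∈ Matrix.unitaryGroup n 𝕜)
    (hV : ∀ b, V b ∈ Matrix.unitaryGroup n 𝕜) {ε : ℝ} (hε : ∀ b, ‖V b - U b‖ ≤ ε) {γ : ℝ}
    (hγ : ∀ μ ν, μ ≠ ν → ∀ x, ∀ u : EuclideanSpace 𝕜 n, RCLike.re ⟪u, Matrix.toEuclideanLin (kingPlaq K U x μ ν) u⟫_𝕜 ≤ γ * ‖u‖ ^ 2) (v : Tor K × n → 𝕜) :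
    (m2 + ((d : ℝ) + 1) * c * plaqGap (γ + 4 * ε)) * ∑ x, ‖fib K v x‖ ^ 2 ≤ RCLike.re (star v ⬝ᵥ (covLapF K c m2 V *ᵥ v)) :=
  re_quadForm_covLapF_ge_plaq_all K hd hc m2 hV (fun μ ν hμν => plaq_hyp_of_near K hU hV hε (hγ μ ν hμν)) v

end Near

/-! ## §3 Open balls around the flux field and around the Kogut–Susskind field -/

section Balls

variable [hK : ∀ μ, NeZero (K μ)] {c : ℝ}

/-- ★★★ **NEAR THE CONSTANT-FLUX FIELD** (`U(1)`, `ν₀ ≠ ν₁`, `c ≥ 0`): every unitary `V` with `‖V(b) − fluxLink(b)‖ ≤ ε` on every bond — an arbitrary INHOMOGENEOUS perturbation — satisfies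
`(m² + 2c·λ(cos p′_{ν₀} + 4ε))·Σ|v_x|² ≤ Re⟨v,(−cΔ_V+m²)v⟩`. [cite: DodziukMathai2006, Cor 1.3 §1; tHooft1979Flux, NPB 153 (flux sectors, notion); King1986, (4.4) p.670] -/
theorem re_quadForm_covLapF_ge_near_fluxLink (hc : 0 ≤ c) (m2 : ℝ) (p : Tor K) {ν₀ ν₁ : Fin (d + 1)} (hν : ν₀ ≠ ν₁) {V : Tor K × Fin (d + 1) → Matrix Unit Unit ℂ}
    (hV : ∀ b, V b ∈ Matrix.unitaryGroup Unit ℂ) {ε : ℝ} (hε : ∀ b, ‖V b - fluxLink K p ν₁ b‖ ≤ ε) (v : Tor K × Unit → ℂ) :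
    (m2 + 2 * c * plaqGap (Real.cos (sOf K p ν₀) + 4 * ε)) * ∑ x, ‖fib K v x‖ ^ 2 ≤ RCLike.re (star v ⬝ᵥ (covLapF K c m2 V *ᵥ v)) :=
  re_quadForm_covLapF_ge_plaq_of_near K hc m2 (fluxLink_mem_unitaryGroup K p ν₁) hV hε hν
    (fun x u => by rw [re_inner_plaq_unit]; exact mul_le_mul_of_nonneg_right (re_kingPlaq_fluxLink K p hν x).le (sq_nonneg _)) v

/-- ★★ **THE MASSLESS GAP SURVIVES**: for `c > 0`, `cos p′_{ν₀} + 4ε < 1` (e.g. `ε < (1 − cos p′)∕4`), every unitary `V` in that ball has `−cΔ_V ≻ 0` (massless, positive definite).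
[cite: DodziukMathai2006, Cor 1.3 §1; Balaban1985BackgroundPropagators, (3.23) p.394] -/
theorem posDef_covLapF_massless_near_fluxLink (hc : 0 < c) (p : Tor K) {ν₀ ν₁ : Fin (d + 1)} (hν : ν₀ ≠ ν₁) {V : Tor K × Fin (d + 1) → Matrix Unit Unit ℂ}
    (hV : ∀ b, V b ∈ Matrix.unitaryGroup Unit ℂ) {ε : ℝ} (hε : ∀ b, ‖V b - fluxLink K p ν₁ b‖ ≤ ε) (hsmall : Real.cos (sOf K p ν₀) + 4 * ε < 1) : (covLapF K c 0 V).PosDef := by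
  refine posDef_covLapF_of_plaq K hc.le hV hν (γ := Real.cos (sOf K p ν₀) + 4 * ε)
    (plaq_hyp_of_near K (fluxLink_mem_unitaryGroup K p ν₁) hV hε
      (fun x u => by rw [re_inner_plaq_unit]; exact mul_le_mul_of_nonneg_right (re_kingPlaq_fluxLink K p hν x).le (sq_nonneg _))) ?_
  rw [zero_add]
  exact mul_pos (mul_pos two_pos hc) (plaqGap_pos_of_lt_one hsmall)

/-- ★★★ **NEAR THE KOGUT–SUSSKIND FIELD** (any fibre `𝕜ⁿ`, all `K` even, `d ≥ 1`, `c ≥ 0`): every unitary `U(n)`-valued field `V` with `‖V(x,μ) − η_μ(x)·1‖ ≤ ε` on every bond —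
NON-ABELIAN, NON-CONSTANT — satisfies `(m² + (d+1)c·λ(4ε − 1))·Σ‖v_x‖² ≤ Re⟨v,(−cΔ_V+m²)v⟩`. [cite: DodziukMathai2006, Cor 1.3 §1; King1986, (4.4) p.670; Balaban1985BackgroundPropagators, (3.23) p.394] -/
theorem re_quadForm_covLapF_ge_near_ks (hd : 0 < d) (hc : 0 ≤ c) (m2 : ℝ) (hK2 : ∀ μ, Even (K μ)) {V : Tor K × Fin (d + 1) → Matrix n n 𝕜} (hV : ∀ b, V b ∈ Matrix.unitaryGroup n 𝕜)
    {ε : ℝ} (hε : ∀ b, ‖V b - ksLink K b‖ ≤ ε) (v : Tor K × n → 𝕜) :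
    (m2 + ((d : ℝ) + 1) * c * plaqGap (4 * ε - 1)) * ∑ x, ‖fib K v x‖ ^ 2 ≤ RCLike.re (star v ⬝ᵥ (covLapF K c m2 V *ᵥ v)) := by
  have h := re_quadForm_covLapF_ge_plaq_all_of_near K hd hc m2 (ksLink_mem_unitaryGroup K) hV hε (γ := -1)
    (fun μ ν hμν x u => by rw [kingPlaq_ks K (n := n) (𝕜 := 𝕜) hK2 hμν x, re_inner_toEuclideanLin_neg_one]) v
  rwa [show (-1 : ℝ) + 4 * ε = 4 * ε - 1 by ring] at h

/-- ★★★ **AN OPEN BALL OF NON-ABELIAN FIELDS WITH A UNIFORM MASSLESS GAP**: for `c > 0`, `ε < 1∕2`, all `K` even, `d ≥ 1` and non-trivial fibre, every unitary `V` with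
`‖V(b) − ksLink(b)‖ ≤ ε` bondwise has `−cΔ_V ≻ 0`, with the uniform lower bound `(d+1)c·λ(4ε−1) > 0` on its spectrum. [cite: DodziukMathai2006, Cor 1.3 §1; Balaban1985BackgroundPropagators, (3.23) p.394] -/
theorem posDef_covLapF_massless_near_ks (hd : 0 < d) (hc : 0 < c) (hK2 : ∀ μ, Even (K μ)) {V : Tor K × Fin (d + 1) → Matrix n n 𝕜} (hV : ∀ b, V b ∈ Matrix.unitaryGroup n 𝕜)
    {ε : ℝ} (hε : ∀ b, ‖V b - ksLink K b‖ ≤ ε) (hsmall : ε < 1 / 2) : (covLapF K c 0 V).PosDef := by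
  refine PosDef.of_dotProduct_mulVec_pos (isHermitian_covLapF K c 0 V) fun v hv => ?_
  have h := re_quadForm_covLapF_ge_near_ks K hd hc.le 0 hK2 hV hε v
  rw [zero_add, sum_norm_fib_sq] at h
  have hgap : 0 < plaqGap (4 * ε - 1) := plaqGap_pos_of_lt_one (by linarith)
  have hκ : 0 < ((d : ℝ) + 1) * c * plaqGap (4 * ε - 1) := by positivity
  have hvn : 0 < ‖(toLp 2 v : EuclideanSpace 𝕜 (Tor K × n))‖ ^ 2 := by
    have : (toLp 2 v : EuclideanSpace 𝕜 (Tor K × n)) ≠ 0 := fun h0 => hv (by simpa using congrArg ofLp h0)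
    positivity
  exact RCLike.pos_iff.mpr ⟨lt_of_lt_of_le (mul_pos hκ hvn) h, im_quadForm_covLapF K c 0 V v⟩

end Balls

/-! ## §4 Gauge invariance of the hypothesis and of the mass -/

section Gauge

variable [hK : ∀ μ, NeZero (K μ)] {c : ℝ}

omit hK in
/-- `Re⟪u, (gPg^*)u⟫ = Re⟪g^*u, P(g^*u)⟫` for any matrices. [folklore] -/
theorem re_inner_conj_plaq (g P : Matrix n n 𝕜) (u : EuclideanSpace 𝕜 n) :
    RCLike.re ⟪u, Matrix.toEuclideanLin (g * P * gᴴ) u⟫_𝕜 = RCLike.re ⟪Matrix.toEuclideanLin gᴴ u, Matrix.toEuclideanLin P (Matrix.toEuclideanLin gᴴ u)⟫_𝕜 := by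
  rw [toEuclideanLin_mul_apply, toEuclideanLin_mul_apply, Matrix.toEuclideanLin_conjTranspose_eq_adjoint, LinearMap.adjoint_inner_left]

omit hK in
/-- ★★ **THE PLAQUETTE HYPOTHESIS IS GAUGE INVARIANT**: `Re⟪u, P_U(x)u⟫ ≤ γ‖u‖²` for all `u` ⟹ the same for `U^g` (`P_{U^g}(x) = g(x)P_U(x)g(x)^*`, Ͻ-q; `g(x)^*` is an isometry).
[cite: Balaban1985BackgroundPropagators, p.398 l.19; King1986, (2.12) p.653] -/
theorem plaq_hyp_kingGaugeAct {U : Tor K × Fin (d + 1) → Matrix n n 𝕜} {g : Tor K → Matrix n n 𝕜} (hg : ∀ x, g x ∈ Matrix.unitaryGroup n 𝕜) {ν₀ ν₁ : Fin (d + 1)} {γ : ℝ}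
    (hγ : ∀ x, ∀ u : EuclideanSpace 𝕜 n, RCLike.re ⟪u, Matrix.toEuclideanLin (kingPlaq K U x ν₀ ν₁) u⟫_𝕜 ≤ γ * ‖u‖ ^ 2) (x : Tor K) (u : EuclideanSpace 𝕜 n) :
    RCLike.re ⟪u, Matrix.toEuclideanLin (kingPlaq K (kingGaugeAct K g U) x ν₀ ν₁) u⟫_𝕜 ≤ γ * ‖u‖ ^ 2 := by
  rw [kingPlaq_kingGaugeAct K hg, re_inner_conj_plaq]
  have hgH : (g x)ᴴ ∈ Matrix.unitaryGroup n 𝕜 := by simpa only [star_eq_conjTranspose] using Unitary.star_mem (hg x)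
  have h := hγ x (Matrix.toEuclideanLin (g x)ᴴ u)
  rwa [norm_toEuclideanLin_of_mem_unitaryGroup hgH] at h

/-- ★★ **THE CURVATURE MASS IS GAUGE INVARIANT**: the bound `(m² + 2c·λ(γ))Σ‖v_x‖² ≤ Re⟨v,(−cΔ_{U^g}+m²)v⟩` holds on the whole gauge orbit of a field with plaquette bound `γ`.
[cite: Balaban1985BackgroundPropagators, p.398 l.19; DodziukMathai2006, Cor 1.3 §1; King1986, (4.4) p.670] -/
theorem re_quadForm_covLapF_ge_plaq_gauge (hc : 0 ≤ c) (m2 : ℝ) {U : Tor K × Fin (d + 1) → Matrix n n 𝕜} (hU : ∀ b, U b ∈ Matrix.unitaryGroup n 𝕜) {g : Tor K → Matrix n n 𝕜}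
    (hg : ∀ x, g x ∈ Matrix.unitaryGroup n 𝕜) {ν₀ ν₁ : Fin (d + 1)} (hν : ν₀ ≠ ν₁) {γ : ℝ}
    (hγ : ∀ x, ∀ u : EuclideanSpace 𝕜 n, RCLike.re ⟪u, Matrix.toEuclideanLin (kingPlaq K U x ν₀ ν₁) u⟫_𝕜 ≤ γ * ‖u‖ ^ 2) (v : Tor K × n → 𝕜) :
    (m2 + 2 * c * plaqGap γ) * ∑ x, ‖fib K v x‖ ^ 2 ≤ RCLike.re (star v ⬝ᵥ (covLapF K c m2 (kingGaugeAct K g U) *ᵥ v)) :=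
  re_quadForm_covLapF_ge_plaq K hc m2 (kingGaugeAct_mem_unitaryGroup K hg hU) hν (plaq_hyp_kingGaugeAct K hg hγ) v

end Gauge

end Summit.QuantumFields.YangMills.BalabanUVNodes.N15KingModelRung.Curvature

end
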